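import Summits.QuantumFields.YangMills.Theorems.LangevinControlUVFemtoCurvatureTwoPointStrictRPDefs

/-!
# Crux `FemtoCurvatureTwoPoint` (stmt-QuantumFields-9363, route `LangevinControlUV`):
# strict positivity of the axis covariance, V — geometry of the lowest transfer step (even torus)

Helper for the registered sub-goal `stub_axisPositive` (`--supports stmt-QuantumFields-9363`).
Lattice bookkeeping for the strict site-reflection positivity argument on the even torus
`(ℤ/L)^d` (reflection `θ' t = −t` of `ConstructiveQFTWave0SiteRPProofs`, positive half
`0 ≤ t ≤ L/2`): the spatial links of the slice `t = 1` (`sliceOneEdges`), the temporal links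
`0 → 1` (`lowEdges`), the bottom spatial links (`bottomEdges`), the temporal plaquettes based in the
slice `t = 0` (`IsLowPlaq`, the lowest transfer step) and their links, the fact that the other
site-positive plaquettes have no link based at `t = 0` (`L ≥ 4`), and gauge transformations
supported on the slice `t = 1` (`gaugeOf`, `splice_gaugeTransform`: they commute with splicing the
site-positive links and conjugate plaquette holonomies).
-/

set_option autoImplicit false

noncomputable section

namespace Summit.QuantumFields.YangMills.Theorems.FemtoCurvatureTwoPoint.StrictRP

open MeasureTheory Finset
open scoped Matrix ComplexConjugate
open Literature.MathematicalPhysics.QuantumFieldTheory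

/-! ### Geometry of the lowest transfer step -/

section Geometry

variable {d L : ℕ} [NeZero d] [NeZero L]






/-- Membership in the slice-one links. -/
@[simp] theorem mem_sliceOneEdges {e : Edge d L} :
    e ∈ (sliceOneEdges : Finset (Edge d L)) ↔ e.2 ≠ 0 ∧ (e.1 0).val = 1 := by
  simp [sliceOneEdges]

/-- Membership in the low temporal links. -/
@[simp] theorem mem_lowEdges {e : Edge d L} :
    e ∈ (lowEdges : Finset (Edge d L)) ↔ e.2 = 0 ∧ (e.1 0).val = 0 := by
  simp [lowEdges]

/-- Membership in the bottom spatial links. -/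
@[simp] theorem mem_bottomEdges {e : Edge d L} :
    e ∈ (bottomEdges : Finset (Edge d L)) ↔ e.2 ≠ 0 ∧ (e.1 0).val = 0 := by
  simp [bottomEdges]

omit [NeZero d] [NeZero L] in
/-- A residue of value `0` is `0`. [folklore] -/
theorem eq_zero_of_val_eq_zero {t : ZMod L} (ht : t.val = 0) : t = 0 :=
  (ZMod.val_eq_zero t).1 ht

variable [Fact (1 < L)]

omit [NeZero d] [NeZero L] in
/-- A residue of value `1` is `1`. [folklore] -/
theorem eq_one_of_val_eq_one {t : ZMod L} (ht : t.val = 1) : t = 1 :=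
  ZMod.val_injective L (by rw [ht, ZMod.val_one])

/-- Time of `x + e₀` when `x` is at time `0`. [folklore] -/
theorem val_shift_zero_of_val_eq_zero {x : Site d L} (hx : (x 0).val = 0) :
    ((x.shift 0) 0).val = 1 := by
  have h1 : 1 < L := Fact.out
  rw [WilsonRP.val_shift_self, hx]
  rw [if_neg (by omega)]

omit [NeZero L] in
/-- Low plaquettes are site-positive (`L ≥ 2`). [folklore] -/
theorem isSitePosPlaq_of_isLowPlaq {p : Plaquette d L} (hp : IsLowPlaq p) :
    WilsonSiteRP.IsSitePosPlaq p := by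
  unfold WilsonSiteRP.IsSitePosPlaq
  rw [if_pos hp.1, hp.2]
  have : 1 < L := Fact.out
  omega

/-- The four links of a low plaquette: temporal `0 → 1`, spatial at `t = 1`, temporal `0 → 1`,
spatial at `t = 0`. [folklore] -/
theorem edges_of_isLowPlaq {p : Plaquette d L} (hp : IsLowPlaq p) :
    (p.1, p.2.1.1) ∈ (lowEdges : Finset (Edge d L)) ∧
      (p.1.shift p.2.1.1, p.2.1.2) ∈ (sliceOneEdges : Finset (Edge d L)) ∧
      (p.1.shift p.2.1.2, p.2.1.1) ∈ (lowEdges : Finset (Edge d L)) ∧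
      (p.1, p.2.1.2) ∈ (bottomEdges : Finset (Edge d L)) := by
  have hj : p.2.1.2 ≠ 0 := WilsonRP.plaq_snd_ne_zero p
  obtain ⟨hi, ht⟩ := hp
  refine ⟨?_, ?_, ?_, ?_⟩
  · rw [mem_lowEdges]; exact ⟨hi, ht⟩
  · rw [mem_sliceOneEdges, hi]; exact ⟨hj, val_shift_zero_of_val_eq_zero ht⟩
  · rw [mem_lowEdges, WilsonRP.val_shift_of_ne _ hj.symm]; exact ⟨hi, ht⟩
  · rw [mem_bottomEdges]; exact ⟨hj, ht⟩

/-- A site-positive plaquette which is not low has no link based in the slice `t = 0`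
(`L ≥ 4`, so that `L/2 + 1 < L`). [folklore] -/
theorem val_ne_zero_of_rest (hL4 : 4 ≤ L) {p : Plaquette d L} (hp : WilsonSiteRP.IsSitePosPlaq p)
    (hnl : ¬ IsLowPlaq p) :
    (p.1 0).val ≠ 0 ∧ ((p.1.shift p.2.1.1) 0).val ≠ 0 ∧ ((p.1.shift p.2.1.2) 0).val ≠ 0 ∧
      (p.1 0).val ≠ 0 := by
  have hj : p.2.1.2 ≠ 0 := WilsonRP.plaq_snd_ne_zero p
  unfold WilsonSiteRP.IsSitePosPlaq at hp
  unfold IsLowPlaq at hnl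
  by_cases hi : p.2.1.1 = 0
  · rw [if_pos hi] at hp
    have ht : (p.1 0).val ≠ 0 := fun h => hnl ⟨hi, h⟩
    refine ⟨ht, ?_, ?_, ht⟩
    · rw [hi, WilsonRP.val_shift_self]
      split_ifs <;> omega
    · rw [WilsonRP.val_shift_of_ne _ hj.symm]; exact ht
  · rw [if_neg hi] at hp
    have ht : (p.1 0).val ≠ 0 := by omega
    refine ⟨ht, ?_, ?_, ht⟩
    · rw [WilsonRP.val_shift_of_ne _ (Ne.symm hi)]; exact ht
    · rw [WilsonRP.val_shift_of_ne _ hj.symm]; exact ht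

omit [NeZero L] [Fact (1 < L)] in
/-- Links based in the slice `t = 1` are site-positive when `L ≥ 4`. [folklore] -/
theorem isSitePosEdge_of_val_eq_one (hL4 : 4 ≤ L) {e : Edge d L} (he : (e.1 0).val = 1) :
    WilsonSiteRP.IsSitePosEdge e := by
  unfold WilsonSiteRP.IsSitePosEdge
  split_ifs <;> omega

omit [NeZero L] in
/-- Temporal links `0 → 1` are site-positive. [folklore] -/
theorem isSitePosEdge_of_mem_lowEdges [NeZero L] {e : Edge d L}
    (he : e ∈ (lowEdges : Finset (Edge d L))) : WilsonSiteRP.IsSitePosEdge e := by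
  rw [mem_lowEdges] at he
  unfold WilsonSiteRP.IsSitePosEdge
  rw [if_pos he.1, he.2]
  have : 1 < L := Fact.out
  omega

omit [Fact (1 < L)] in
/-- Slice-one links are site-positive when `L ≥ 4`. [folklore] -/
theorem isSitePosEdge_of_mem_sliceOneEdges (hL4 : 4 ≤ L) {e : Edge d L}
    (he : e ∈ (sliceOneEdges : Finset (Edge d L))) : WilsonSiteRP.IsSitePosEdge e :=
  isSitePosEdge_of_val_eq_one hL4 (mem_sliceOneEdges.1 he).2

omit [Fact (1 < L)] in
/-- Bottom spatial links are not site-positive. [folklore] -/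
theorem not_isSitePosEdge_of_mem_bottomEdges {e : Edge d L}
    (he : e ∈ (bottomEdges : Finset (Edge d L))) : ¬ WilsonSiteRP.IsSitePosEdge e := by
  rw [mem_bottomEdges] at he
  unfold WilsonSiteRP.IsSitePosEdge
  rw [if_neg he.1, he.2]
  omega

end Geometry

/-! ### Gauge transformations supported on the slice `t = 1` -/

section Gauge

variable {d L N : ℕ} [NeZero d] [NeZero L] [Fact (1 < L)] {G : Type*} [Group G]
  (ρ : G →* Matrix (Fin N) (Fin N) ℂ)

omit [NeZero d] [NeZero L] [Fact (1 < L)] in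
/-- Plaquette holonomies transform by conjugation under gauge transformations. [folklore] -/
theorem plaquetteHolonomy_gaugeTransform' (g : Site d L → G) (U : GaugeConfig d L G)
    (x : Site d L) (i j : Fin d) :
    plaquetteHolonomy (gaugeTransform g U) x i j = g x * plaquetteHolonomy U x i j * (g x)⁻¹ := by
  have hshift : (x.shift j).shift i = (x.shift i).shift j := by
    simp only [Site.shift, add_assoc, add_comm (Pi.single (M := fun _ => ZMod L) j 1)]
  simp only [plaquetteHolonomy, gaugeTransform, hshift, mul_inv_rev, inv_inv]
  group

omit [NeZero d] [NeZero L] [Fact (1 < L)] in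
/-- Plaquette functions are gauge invariant. [folklore] -/
theorem plaqRe_gaugeTransform (g : Site d L → G) (U : GaugeConfig d L G) (p : Plaquette d L) :
    WilsonRP.plaqRe ρ (gaugeTransform g U) p = WilsonRP.plaqRe ρ U p := by
  unfold WilsonRP.plaqRe
  rw [plaquetteHolonomy_gaugeTransform', map_mul, map_mul, Matrix.trace_mul_cycle, ← map_mul,
    inv_mul_cancel, map_one, Matrix.one_mul]


omit [NeZero L] [Fact (1 < L)] in
/-- `γ_Y = 1` off the slice `t = 1`. -/
theorem gaugeOf_of_ne (Y : GaugeConfig d L G) {x : Site d L} (hx : (x 0).val ≠ 1) : gaugeOf Y x = 1 := by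
  simp [gaugeOf, hx]

omit [NeZero L] [Fact (1 < L)] in
/-- `γ_Y(x) = Y(x − e₀, 0)` on the slice `t = 1`. -/
theorem gaugeOf_of_eq (Y : GaugeConfig d L G) {x : Site d L} (hx : (x 0).val = 1) :
    gaugeOf Y x = Y (x - Pi.single 0 1, 0) := by
  simp [gaugeOf, hx]

/-- A gauge transformation supported on the slice `t = 1` only moves site-positive links
(`L ≥ 4`). [folklore] -/
theorem gaugeTransform_apply_of_not_isSitePosEdge (hL4 : 4 ≤ L) {γ : Site d L → G}
    (hγ : ∀ x : Site d L, (x 0).val ≠ 1 → γ x = 1) (U : GaugeConfig d L G) {e : Edge d L}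
    (he : ¬ WilsonSiteRP.IsSitePosEdge e) : gaugeTransform γ U e = U e := by
  have h1 : (e.1 0).val ≠ 1 := fun h => he (isSitePosEdge_of_val_eq_one hL4 h)
  have h2 : ((e.1.shift e.2) 0).val ≠ 1 := by
    intro h
    by_cases hi : e.2 = 0
    · -- temporal link ending at time 1 starts at time 0: it is positive
      apply he
      unfold WilsonSiteRP.IsSitePosEdge
      rw [if_pos hi]
      rw [hi, WilsonRP.val_shift_self] at h
      split_ifs at h with htop
      all_goals omega
    · rw [WilsonRP.val_shift_of_ne _ (Ne.symm hi)] at h; exact h1 h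
  simp only [gaugeTransform, hγ _ h1, hγ _ h2, one_mul, inv_one, mul_one]

/-- Splicing the site-positive links commutes with gauge transformations supported on the slice
`t = 1`. [folklore] -/
theorem splice_gaugeTransform (hL4 : 4 ≤ L) {γ : Site d L → G}
    (hγ : ∀ x : Site d L, (x 0).val ≠ 1 → γ x = 1) (V W : GaugeConfig d L G) :
    LatticeRP.splice WilsonSiteRP.sitePosEdges (V, gaugeTransform γ W) =
      gaugeTransform γ (LatticeRP.splice WilsonSiteRP.sitePosEdges (V, W)) := by
  funext e
  by_cases he : WilsonSiteRP.IsSitePosEdge e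
  · have hmem : e ∈ (WilsonSiteRP.sitePosEdges : Finset (Edge d L)) :=
      WilsonSiteRP.mem_sitePosEdges.2 he
    simp only [gaugeTransform, LatticeRP.splice_apply, if_pos hmem]
  · have hmem : e ∉ (WilsonSiteRP.sitePosEdges : Finset (Edge d L)) := fun h =>
      he (WilsonSiteRP.mem_sitePosEdges.1 h)
    rw [gaugeTransform_apply_of_not_isSitePosEdge hL4 hγ _ he]
    simp only [LatticeRP.splice_apply, if_neg hmem]

end Gauge

/-- **Registered sub-goal `stub_sliceGaugeSplice`** (`--supports stmt-QuantumFields-9363`): closed form of `splice_gaugeTransform` — gauge transformations supported on the slice `t = 1` commute with splicing the site-positive links (`L ≥ 4`). [folklore] -/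
theorem stub_sliceGaugeSplice : ∀ (d L : ℕ) [NeZero d] [NeZero L] [Fact (1 < L)] (G : Type) [Group G], 4 ≤ L → ∀ (γ : Literature.MathematicalPhysics.QuantumFieldTheory.Site d L → G), (∀ x : Literature.MathematicalPhysics.QuantumFieldTheory.Site d L, (x 0).val ≠ 1 → γ x = 1) → ∀ (V W : Literature.MathematicalPhysics.QuantumFieldTheory.GaugeConfig d L G), Literature.MathematicalPhysics.QuantumFieldTheory.LatticeRP.splice Literature.MathematicalPhysics.QuantumFieldTheory.WilsonSiteRP.sitePosEdges (V, Literature.MathematicalPhysics.QuantumFieldTheory.gaugeTransform γ W) = Literature.MathematicalPhysics.QuantumFieldTheory.gaugeTransform γ (Literature.MathematicalPhysics.QuantumFieldTheory.LatticeRP.splice Literature.MathematicalPhysics.QuantumFieldTheory.WilsonSiteRP.sitePosEdges (V, W)) := by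
  intro d L _ _ _ G _ hL4 γ hγ V W
  exact splice_gaugeTransform hL4 hγ V W

end Summit.QuantumFields.YangMills.Theorems.FemtoCurvatureTwoPoint.StrictRP

end
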